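import Summits.BirchSwinnertonDyer.BirchSwinnertonDyer.Theorems.ErratumRoadFiveNonSurjCornerTateParameter
import Summits.BirchSwinnertonDyer.BirchSwinnertonDyer.Theorems.ErratumRoadFiveNonSurjCornerTwinMuAnSplitLinearCoefficient
import Literature.NumberTheory.EllipticCurves.TateJTransport
import Literature.NumberTheory.EllipticCurves.PAdicHeights
import Mathlib.NumberTheory.Padics.HeightOneSpectrum
import HarnessLib

/-!
# Route `ErratumRoadFive` (rung K2), crux `NonSurjCorner` (19065) ∕ child `NonSurjCornerTwinMuAn` (19948): THE TATE PARAMETER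
# DATUM `Dq : TateParameterData W p` (over `ℚ_[p]`) IS A `p`-TH POWER whenever `p ∤ #ρ̄_{E,p}(Γ_ℚ)` — g3's adic-completion
# theorem transported along Mathlib's `adicCompletion.padicEquiv` (cell `bsd-stepL`, seat `bsd-stepL-corner5-p2` g6,
# WIDTH-LEVER lane B; `--supports stmt-BirchSwinnertonDyer-19948 --as helper`)

WHAT. This lane's g3 proved `NonSurjCorner.exists_pow_eq_tateParameter` ∕ `exists_pow_eq_tateParameter_of_mult_of_not_dvd_card`
for a Tate parameter `q ∈ ℚ_v = v.adicCompletion ℚ` (`v` the place of `p`). The `p`-adic `L`-function files of the tree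
(`PAdicHeights`, `PAdicBSD`: `TateParameterData W p`, `LInvariant`, `greenberg_stevens`) speak `ℚ_[p]`. This file moves the
`p`-th-power statement across Mathlib's continuous `ℚ`-algebra isomorphism `e = adicCompletion.padicEquiv v : ℚ_v ≃A[ℚ] ℚ_[p]`:
`e` and `e⁻¹` preserve «`‖·‖ < 1`» (both map the valuation ring onto the valuation ring, `padicEquiv_bijOn`, hence units onto
units), and `j(q)` is transported by the tree's `map_tateJ` (continuous ring maps out of a complete field commute with the
`q`-expansions). Consequence: the binder `hpow : ∃ r : ℚ_[p], r ^ p = Dq.q` of this seat's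
`…TwinMuAnSplitLinearCoefficient` (p583928) is DISCHARGED for every `W` with `Mult W p`, `E[p]` irreducible, `ρ̄_{E,p}` not onto
(`p` odd) — in particular at every corner pair and every X11a twin of the corner.

* §1 `norm_padicEquiv_lt_one`, `norm_padicEquiv_symm_lt_one` — `‖·‖ < 1` is preserved both ways.
* §2 **`TateParameterData.exists_pow_eq_q_of_not_dvd_card`**, **`TateParameterData.exists_pow_eq_q_of_irr_of_not_surj`**.
* §3 **`NonSurjTwin.norm_coeff_one_le`**, **`NonSurjTwin.two_le_of_norm_coeff_eq_one`** — p583928's conclusions on the X11a twins of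
  the corner with the binder `hpow` DISCHARGED: at a split `p` which is the only split place, `‖[T¹](ϖ·L)‖ ≤ ‖#Ш_an‖_p/p`, and for
  `p`-integral `#Ш_an` any unit coefficient of `ϖ·L` has index `≥ 2`.

HONEST FRAMING: theorems only (no definition, no named fact, no `sorry`); a transport lemma; nothing about BSD (T7).
References: [SilvermanATAEC1994] Thm. V.3.1 (b),(d), Lemma V.5.1, Thm. V.5.3; [MochizukiGenEll2010] Lemma 3.2 (i); [Serre1972] §2.4
Prop. 15; tree: g3's `…NonSurjCornerTateParameter` (p549xxx), `TateJTransport` (`map_tateJ`), Mathlib `Padics/HeightOneSpectrum`.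
-/

set_option autoImplicit false
set_option linter.dupNamespace false

noncomputable section

open scoped Classical NumberField
open IsDedekindDomain Field WeierstrassCurve Rat.HeightOneSpectrum
  Literature.NumberTheory.EllipticCurves Literature.NumberTheory.EllipticCurves.Rank1Residual

namespace Summit.BirchSwinnertonDyer.BirchSwinnertonDyer.Theorems.TatePow

/-! ### §1 `padicEquiv` preserves `‖·‖ < 1` -/

section NormTransport

variable (v : HeightOneSpectrum (𝓞 ℚ)) [Fact (primesEquiv v : ℕ).Prime]

/-- `‖x‖ ≤ 1` in `ℚ_v` iff `‖e x‖ ≤ 1` in `ℚ_[p]` (`e = padicEquiv v`; both are «`x` is an integer», `padicEquiv_bijOn`). [folklore] -/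
theorem norm_padicEquiv_le_one_iff (x : v.adicCompletion ℚ) :
    ‖adicCompletion.padicEquiv v x‖ ≤ 1 ↔ ‖x‖ ≤ 1 := by
  have hbij := adicCompletion.padicEquiv_bijOn (R := 𝓞 ℚ) v
  have hint : ∀ y : v.adicCompletion ℚ, ‖y‖ ≤ 1 ↔ y ∈ (v.adicCompletionIntegers ℚ : Set (v.adicCompletion ℚ)) :=
    fun y ↦ (Valued.toNormedField.norm_le_one_iff).trans
      (HeightOneSpectrum.mem_adicCompletionIntegers (𝓞 ℚ) ℚ v).symm
  constructor
  · intro h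
    have hmem : adicCompletion.padicEquiv v x ∈ (PadicInt.subring (primesEquiv v : ℕ) : Set ℚ_[primesEquiv v]) :=
      (PadicInt.mem_subring_iff _).mpr h
    obtain ⟨y, hy, hyx⟩ := hbij.surjOn hmem
    have : y = x := (adicCompletion.padicEquiv v).injective hyx
    subst this
    exact (hint y).mpr hy
  · intro h
    exact (PadicInt.mem_subring_iff _).mp (hbij.mapsTo ((hint x).mp h))

/-- **`‖x‖ < 1` in `ℚ_v` iff `‖e x‖ < 1` in `ℚ_[p]`**: a non-unit integer stays a non-unit integer (apply `norm_padicEquiv_le_one_iff`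
to `x` and to `x⁻¹`). [folklore] -/
theorem norm_padicEquiv_lt_one_iff (x : v.adicCompletion ℚ) :
    ‖adicCompletion.padicEquiv v x‖ < 1 ↔ ‖x‖ < 1 := by
  by_cases hx : x = 0
  · subst hx; simp
  have hex : adicCompletion.padicEquiv v x ≠ 0 := (map_ne_zero _).mpr hx
  constructor
  · intro h
    by_contra hge
    push Not at hge
    -- `‖x⁻¹‖ ≤ 1`, so `‖e x⁻¹‖ ≤ 1`, i.e. `‖(e x)⁻¹‖ ≤ 1`, contradicting `‖e x‖ < 1`
    have h1 : ‖x⁻¹‖ ≤ 1 := by rw [norm_inv]; exact inv_le_one_of_one_le₀ hge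
    have h2 := (norm_padicEquiv_le_one_iff v x⁻¹).mpr h1
    rw [map_inv₀, norm_inv] at h2
    have h3 : 1 ≤ ‖adicCompletion.padicEquiv v x‖ := by
      by_contra hlt; push Not at hlt
      have hpos : 0 < ‖adicCompletion.padicEquiv v x‖ := norm_pos_iff.mpr hex
      have : 1 < ‖adicCompletion.padicEquiv v x‖⁻¹ := (one_lt_inv₀ hpos).mpr hlt
      linarith
    linarith
  · intro h
    by_contra hge
    push Not at hge
    have h1 : ‖(adicCompletion.padicEquiv v x)⁻¹‖ ≤ 1 := by rw [norm_inv]; exact inv_le_one_of_one_le₀ hge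
    rw [← map_inv₀] at h1
    have h2 := (norm_padicEquiv_le_one_iff v x⁻¹).mp h1
    rw [norm_inv] at h2
    have hpos : 0 < ‖x‖ := norm_pos_iff.mpr hx
    have : 1 < ‖x‖⁻¹ := (one_lt_inv₀ hpos).mpr h
    linarith

/-- `‖e⁻¹ y‖ < 1 ↔ ‖y‖ < 1`. [folklore] -/
theorem norm_padicEquiv_symm_lt_one_iff (y : ℚ_[primesEquiv v]) :
    ‖(adicCompletion.padicEquiv v).symm y‖ < 1 ↔ ‖y‖ < 1 := by
  have := norm_padicEquiv_lt_one_iff v ((adicCompletion.padicEquiv v).symm y)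
  rw [ContinuousAlgEquiv.apply_symm_apply] at this
  exact this.symm

end NormTransport

/-! ### §2 The Tate parameter datum is a `p`-th power -/

variable (W : WeierstrassCurve ℚ) [W.IsElliptic] (p : ℕ) [hp : Fact p.Prime]

/-- **`Dq.q` IS A `p`-TH POWER IN `ℚ_p` when `p ∤ #ρ̄_{E,p}(Γ_ℚ)`** (`p` odd, `p` multiplicative): g3's
`exists_pow_eq_tateParameter_of_mult_of_not_dvd_card` over `ℚ_v`, transported along `padicEquiv`: `q' = e⁻¹(Dq.q)` is a Tate
parameter in `ℚ_v` (`‖q'‖ < 1` by §1, `j(q') = j(W)` by `map_tateJ` applied to the continuous `e⁻¹`), so `q' = r'^p`, and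
`Dq.q = e(q') = (e r')^p`. [cite: SilvermanATAEC1994, Thm. V.3.1 (b),(d), Thm. V.5.3] [cite: MochizukiGenEll2010, §3 Lemma 3.2 (i)] -/
theorem TateParameterData.exists_pow_eq_q_of_not_dvd_card (hp2 : p ≠ 2) (hmult : Mult W p)
    (hG : ¬ p ∣ Nat.card (galoisRepTorsion W p).range)
    (Dq : TateParameterData W p) : ∃ r : ℚ_[p], r ^ p = Dq.q := by
  -- make `p` literally `primesEquiv v`
  obtain ⟨v, hv⟩ := (primesEquiv (R := 𝓞 ℚ)).surjective ⟨p, hp.out⟩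
  have hvp : ((primesEquiv v : Nat.Primes) : ℕ) = p := congrArg Subtype.val hv
  subst hvp
  set e := adicCompletion.padicEquiv (R := 𝓞 ℚ) v with he
  set q' : v.adicCompletion ℚ := e.symm Dq.q with hq'
  have hq'0 : q' ≠ 0 := by rw [hq']; exact (map_ne_zero _).mpr Dq.q_ne_zero
  have hq'n : ‖q'‖ < 1 := (norm_padicEquiv_symm_lt_one_iff v Dq.q).mpr Dq.norm_q_lt_one
  -- `j(q') = j(W)` in `ℚ_v`
  have hqj' : Literature.NumberTheory.EllipticCurves.tateJ q' = (W.baseChange (v.adicCompletion ℚ)).j := by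
    have hmap := Literature.NumberTheory.EllipticCurves.map_tateJ (e.symm : ℚ_[primesEquiv v] →+* v.adicCompletion ℚ)
      e.symm.continuous Dq.norm_q_lt_one
    rw [hq']
    change Literature.NumberTheory.EllipticCurves.tateJ ((e.symm : ℚ_[primesEquiv v] →+* v.adicCompletion ℚ) Dq.q) = _
    rw [← hmap, Dq.tateJ_eq]
    change e.symm (algebraMap ℚ ℚ_[primesEquiv v] W.j) = (W.map (algebraMap ℚ (v.adicCompletion ℚ))).j
    rw [WeierstrassCurve.map_j]
    exact e.symm.toAlgEquiv.commutes W.j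
  obtain ⟨r', hr'⟩ :=
    CornerLocal.exists_pow_eq_tateParameter_of_mult_of_not_dvd_card W
      (primesEquiv v : ℕ) hp2 hmult hG rfl hq'0 hq'n hqj'
  refine ⟨e r', ?_⟩
  rw [← map_pow, hr', hq', ContinuousAlgEquiv.apply_symm_apply]

/-- **The same on the cells of the corner: `E[p]` irreducible and `ρ̄_{E,p}` NOT onto** (then `p ∤ #ρ̄(Γ_ℚ)`, Serre Prop. 15) —
every corner pair (`ClassX11b ∧ ¬Surj`) and every X11a twin of the corner (`ClassX11a ∧ ¬Surj`) at a SPLIT `p`: the Tate parameter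
datum is a `p`-th power, `∃ r : ℚ_[p], r ^ p = Dq.q` — the binder `hpow` of `…TwinMuAnSplitLinearCoefficient`.
[cite: Serre1972, §2.4 Prop. 15] [cite: SilvermanATAEC1994, Thm. V.5.3] -/
theorem TateParameterData.exists_pow_eq_q_of_irr_of_not_surj (hp2 : p ≠ 2) (hmult : Mult W p) (hirr : Irr W p)
    (hns : ¬ Surj W p) (Dq : TateParameterData W p) : ∃ r : ℚ_[p], r ^ p = Dq.q := by
  obtain ⟨e, Φ, he, -⟩ := exists_frame_galoisRepTorsion_rat W p
  have hG : ¬ p ∣ Nat.card (galoisRepTorsion W p).range := by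
    rw [← card_map_range_galoisRepTorsion W p Φ]
    exact not_dvd_card_of_not_hasSurjectiveModNGaloisRep W p Φ e he hirr hns
  exact TateParameterData.exists_pow_eq_q_of_not_dvd_card W p hp2 hmult hG Dq

/-! ### §3 The split-branch linear coefficient on the corner twins, `hpow` discharged -/

section Twins

open CongruenceSubgroup Literature.NumberTheory.EllipticCurves.ModularForms Summit.BirchSwinnertonDyer.Rank1Residual
  Summit.BirchSwinnertonDyer.Rank1Residual.X11b.MuAnUnit
open scoped MatrixGroups ModularForm

variable {W p} [W.IsGloballyMinimal] {N : ℕ} [NeZero N] {f : CuspForm (Gamma0 N) 2}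

/-- **`‖[T¹](ϖ·L)‖_p ≤ p⁻¹·‖#Ш(Wd)_an‖_p` on an X11a twin of the corner** (`ClassX11a ∧ ¬Surj`, `p ∈ {5,7}` so `p` odd and `≥ 5`),
SPLIT at `p` with `p` the only split place, GZK + Greenberg–Stevens by name: p583928's bound with `hpow` discharged by §2.
[cite: SkinnerZhang2014, Thm. 1.3 (c)] [cite: Kobayashi2006DocMath, Cor. 4.2] -/
theorem NonSurjTwin.norm_coeff_one_le (hGZK : rank_eq_analyticRank_of_analyticRank_le_one) (hXa : ClassX11a W p)
    (hns : ¬ Surj W p) (h57 : p = 5 ∨ p = 7) (hGS : greenberg_stevens (W := W) (p := p)) (Dq : TateParameterData W p)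
    (huniq : ∀ v : HeightOneSpectrum (𝓞 ℚ), W.HasSplitMultiplicativeReductionAt v →
      v = (Rat.HeightOneSpectrum.primesEquiv (R := 𝓞 ℚ)).symm ⟨p, Fact.out⟩)
    (hf : IsNewformOf W f) {ϖ : ℚ} (hϖ : (ϖ : ℝ) * W.realPeriodRat = plusPeriod f)
    {L : PowerSeries ℚ_[p]} (hL : IsMultPAdicLFunctionOf f p 1 L) {q : ℚ} (hq : shaAn W = (q : ℂ)) (hq0 : q ≠ 0) :
    ‖PowerSeries.coeff 1 (PowerSeries.C ((ϖ : ℚ) : ℚ_[p]) * L)‖ ≤ (p : ℝ)⁻¹ * ‖((q : ℚ) : ℚ_[p])‖ := by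
  have hp2 : p ≠ 2 := by rcases h57 with rfl | rfl <;> decide
  have hp5 : 5 ≤ p := by rcases h57 with rfl | rfl <;> norm_num
  exact norm_coeff_one_C_mul_le_of_pow hp2 hp5 hGZK hXa hGS Dq
    (TateParameterData.exists_pow_eq_q_of_irr_of_not_surj W p hp2 hXa.2.2.1 hXa.2.2.2.1 hns Dq) huniq hf hϖ hL hq hq0

/-- **On the corner's split twins the analytic μ = 0 certificate has index `≥ 2`** (for `p`-integral `#Ш(Wd)_an`): under the frame
of `stub_twinMuAn_split` (19948) with `p` the only split place, GZK + Greenberg–Stevens by name and `shaAn Wd = q`, `q ≠ 0`,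
`ord_p q ≥ 0`: `‖[Tⁿ](ϖ·L)‖ = 1 ⟹ 2 ≤ n`. No `hpow` binder. [cite: MazurTateTeitelbaum1986Invent, §I.15] [cite: SkinnerZhang2014, Thm. 1.3 (c)] -/
theorem NonSurjTwin.two_le_of_norm_coeff_eq_one (hGZK : rank_eq_analyticRank_of_analyticRank_le_one)
    (hXa : ClassX11a W p) (hns : ¬ Surj W p) (h57 : p = 5 ∨ p = 7) (hGS : greenberg_stevens (W := W) (p := p))
    (Dq : TateParameterData W p)
    (huniq : ∀ v : HeightOneSpectrum (𝓞 ℚ), W.HasSplitMultiplicativeReductionAt v →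
      v = (Rat.HeightOneSpectrum.primesEquiv (R := 𝓞 ℚ)).symm ⟨p, Fact.out⟩)
    (hf : IsNewformOf W f) {ϖ : ℚ} (hϖ : (ϖ : ℝ) * W.realPeriodRat = plusPeriod f)
    {L : PowerSeries ℚ_[p]} (hL : IsMultPAdicLFunctionOf f p 1 L) {q : ℚ} (hq : shaAn W = (q : ℂ)) (hq0 : q ≠ 0)
    (hint : 0 ≤ padicValRat p q) {n : ℕ} (hn : ‖PowerSeries.coeff n (PowerSeries.C ((ϖ : ℚ) : ℚ_[p]) * L)‖ = 1) : 2 ≤ n := by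
  have hp2 : p ≠ 2 := by rcases h57 with rfl | rfl <;> decide
  have hp5 : 5 ≤ p := by rcases h57 with rfl | rfl <;> norm_num
  exact Summit.BirchSwinnertonDyer.Rank1Residual.X11b.MuAnUnit.two_le_of_norm_coeff_eq_one hp2 hp5 hGZK hXa hGS Dq
    (TateParameterData.exists_pow_eq_q_of_irr_of_not_surj W p hp2 hXa.2.2.1 hXa.2.2.2.1 hns Dq) huniq hf hϖ hL hq hq0 hint hn

end Twins

end Summit.BirchSwinnertonDyer.BirchSwinnertonDyer.Theorems.TatePow

end
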